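import Mathlib.NumberTheory.Padics.Complex
import Mathlib.RingTheory.Polynomial.Cyclotomic.Eval
import Mathlib.RingTheory.Polynomial.Cyclotomic.Roots
import Mathlib.RingTheory.RootsOfUnity.AlgebraicallyClosed
import Mathlib.Analysis.Normed.Group.Ultra
import Literature.NumberTheory.GaloisRepresentations.PadicCharacterNthRoot
import Literature.NumberTheory.GaloisRepresentations.PadicAlgClPointsAutomaticContinuity
import HarnessLib

/-!
# The local cyclotomic tower INSIDE `ℚ̄_p = PadicAlgCl p`, I: a compatible system of `p`-power roots
# of unity `(ζ (m+1))^p = ζ m` and `‖ζ_{p^m} − 1‖^{φ(p^m)} = ‖p‖` — cell `b2b-bsdres`, CLASS-CLOSURE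
# lane, class O10 — x1b GEN 33, class lead; file 18 of the local series (the field side of [K] §8.4,
# Kobayashi's tower `k_n = ℚ_p(ζ_{p^{n+1}})`; port of the tree's `PAdicHodge/CyclotomicTower.lean`
# from the `NormedAlgClosure F` of a local field to Mathlib's `PadicAlgCl p`)

HONEST FRAMING (cell `b2b-bsdres`, run/shared/lean/b2b/bsd-rank1-residual/, verbatim in every
file): the goal of the cell is to DELETE the COMBINATION-SHAPED residual classes of the
Birch–Swinnerton-Dyer formula for ALL analytic-rank `≤ 1` elliptic curves over `ℚ` — "full BSD
formula for every rank `≤ 1` curve in class `C`" assembled STRICTLY from published theorems — so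
that the rank-`≤ 1` remainder becomes exactly the CONSTRUCTION-SHAPED classes, which are TYPED
(missing-input `Prop`s), NOT attempted. This is not "finishing BSD". CLASS-CLOSURE lane: prove
what is provable now; shrink each hard class to its core with data; no claim beyond stated classes;
research routes on CONSTRUCTION-SHAPED X12 / O10; census / instrument output = EVIDENCE / conjecture
items, NEVER a Literature fact; `RESIDUAL-MAP.md` marks change only by signed lines. THIS FILE:
TOOL DEFINITION + THEOREMS (one definition with body: the compatible system `zeta p : ℕ → ℚ̄_p`; no instance;
every statement proved) — no named Literature fact, no Summits-side fact `def … : Prop`, no `sorry`,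
axioms standard; nothing is booked; no label / mark / count / sub-cell moves; O10 stays OPEN /
CONSTRUCTION-SHAPED; nothing about `BSD(W, p)` of any pair is claimed.

## Why

Kobayashi's Prop. 8.12 ii) (the hypothesis `hsum` of the (C3_η) local chain) is a statement about
the formal group of `E` over the LOCAL cyclotomic tower `k_n = ℚ_p(ζ_{p^{n+1}})`, `k_{−1} = ℚ_p`
([K] §8.4): its proof uses `Tr_{k_{n+1}/k_n}(ζ_{p^{n+2}}) = 0`, `[k_{n+1} : k_n] = p`,
`𝒪_{k_n} = ℤ_p[ζ_{p^{n+1}}]` and `log(m_n) ⊆ m_n + k_{n−1}`, with `ζ_{p^{n+1}}^{p^{2k}} = ζ_{p^{n+1−2k}}`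
— a COMPATIBLE system of roots of unity. The cell's local points live over `AlgebraicClosure ℚ_[p]`,
Mathlib's `PadicAlgCl p` (spectral norm); the tree's metric cyclotomic tower
(`PAdicHodge/CyclotomicTower.lean`) lives in the `NormedAlgClosure` of a local field (`ℚ_p` has no
`IsNonarchimedeanLocalField` instance). This file ports its first half.

## What is here (`Ω = PadicAlgCl p`, `ζ m = zeta p m`)

* §1 `zeta p : ℕ → Ω` (recursive choice): `ζ 0 = 1`, `(ζ (m+1))^p = ζ m` (`zeta_succ_pow`),
  `IsPrimitiveRoot (ζ m) (p^m)` (`isPrimitiveRoot_zeta`), `(ζ (m + j))^{p^j} = ζ m` (`zeta_add_pow`),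
  `(ζ m)^{p^j} = 1` for `m ≤ j`, `‖ζ m‖ = 1`, `0 < ‖p‖ < 1`.
* §2 `norm_zeta_sub_one_pow`: `‖ζ m − 1‖^{φ(p^m)} = ‖p‖` (`m ≥ 1`: `∏(1 − μ) = Φ_{p^m}(1) = p` over
  the primitive roots `μ`, all of the same absolute value); `0 < ‖ζ m − 1‖ < 1`, `‖ζ m − 1‖ ≤ 1`.

References: [Kobayashi2003] §8.4; [SerreLocalFields1979] Ch. IV §4 (cyclotomic extensions of
`ℚ_p`: totally ramified of degree `φ(p^m)`, uniformiser `ζ − 1`); [Tate1967] §3.1.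
-/

noncomputable section

open scoped Classical IntermediateField
open Polynomial

namespace Summit.BirchSwinnertonDyer.Rank1Residual.Additive

namespace PadicCyclotomicTower

variable (p : ℕ) [hp : Fact p.Prime]

/-! ## §1 A compatible system of `p`-power roots of unity in `ℚ̄_p` -/

/-- One step of the compatible system: a primitive `p^{m+1}`-th root of unity whose `p`-th power is
a GIVEN primitive `p^m`-th root of unity `z` (take any primitive `p^{m+1}`-th root `μ`; `μ^p` and
`z` are primitive `p^m`-th roots, so `z = (μ^p)^a` with `p ∤ a`, and `μ^a` works). [folklore] -/
theorem exists_primitiveRoot_pow_eq {m : ℕ} {z : PadicAlgCl p} (hz : IsPrimitiveRoot z (p ^ m)) :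
    ∃ y : PadicAlgCl p, IsPrimitiveRoot y (p ^ (m + 1)) ∧ y ^ p = z := by
  obtain ⟨μ, hμ⟩ := HasEnoughRootsOfUnity.exists_primitiveRoot (PadicAlgCl p) (p ^ (m + 1))
  rcases Nat.eq_zero_or_pos m with rfl | hm
  · -- `z = 1`: any primitive `p`-th root
    rw [pow_zero] at hz
    refine ⟨μ, hμ, ?_⟩
    rw [IsPrimitiveRoot.one_right_iff] at hz
    rw [hz]
    have h1 := hμ.pow_eq_one
    rwa [zero_add, pow_one] at h1
  have hμp : IsPrimitiveRoot (μ ^ p) (p ^ m) := by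
    have := hμ.pow_of_dvd hp.out.ne_zero (dvd_pow_self p (Nat.succ_ne_zero m))
    rwa [pow_succ, Nat.mul_div_cancel _ hp.out.pos] at this
  obtain ⟨a, -, hapow⟩ := hμp.eq_pow_of_pow_eq_one hz.pow_eq_one
  have hcop : a.Coprime (p ^ m) := (hμp.pow_iff_coprime (pow_pos hp.out.pos m) a).mp (hapow ▸ hz)
  refine ⟨μ ^ a, hμ.pow_of_coprime a ?_, ?_⟩
  · exact ((Nat.coprime_pow_right_iff hm _ _).mp hcop).pow_right _
  · rw [← pow_mul, mul_comm, pow_mul, hapow]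

/-- **A compatible system of primitive `p^m`-th roots of unity in `ℚ̄_p`**: `ζ 0 = 1` and
`ζ (m + 1)` a primitive `p^{m+1}`-th root with `(ζ (m+1))^p = ζ m` (recursive choice). Kobayashi's
`ζ_{p^{n+1}}` is `ζ (n + 1)`. [cite: Kobayashi2003, §8.4 (k_n = ℚ_p(ζ_{p^{n+1}}))] -/
def zeta : ℕ → PadicAlgCl p
  | 0 => 1
  | m + 1 =>
    if h : IsPrimitiveRoot (zeta m) (p ^ m) then
      (exists_primitiveRoot_pow_eq p h).choose else 1

/-- `ζ m` is a primitive `p^m`-th root of unity and `(ζ (m+1))^p = ζ m`. [folklore] -/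
theorem isPrimitiveRoot_zeta_and (m : ℕ) :
    IsPrimitiveRoot (zeta p m) (p ^ m) ∧ zeta p (m + 1) ^ p = zeta p m := by
  induction m with
  | zero =>
    have h0 : IsPrimitiveRoot (zeta p 0) (p ^ 0) := by
      rw [pow_zero]; exact IsPrimitiveRoot.one
    refine ⟨h0, ?_⟩
    show (if h : IsPrimitiveRoot (zeta p 0) (p ^ 0) then
      (exists_primitiveRoot_pow_eq p h).choose else 1) ^ p = zeta p 0
    rw [dif_pos h0]
    exact (exists_primitiveRoot_pow_eq p h0).choose_spec.2
  | succ m ih =>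
    have h1 : IsPrimitiveRoot (zeta p (m + 1)) (p ^ (m + 1)) := by
      show IsPrimitiveRoot (if h : IsPrimitiveRoot (zeta p m) (p ^ m) then
        (exists_primitiveRoot_pow_eq p h).choose else 1) (p ^ (m + 1))
      rw [dif_pos ih.1]
      exact (exists_primitiveRoot_pow_eq p ih.1).choose_spec.1
    refine ⟨h1, ?_⟩
    show (if h : IsPrimitiveRoot (zeta p (m + 1)) (p ^ (m + 1)) then
      (exists_primitiveRoot_pow_eq p h).choose else 1) ^ p = zeta p (m + 1)
    rw [dif_pos h1]
    exact (exists_primitiveRoot_pow_eq p h1).choose_spec.2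

/-- `ζ m` is a primitive `p^m`-th root of unity. [folklore] -/
theorem isPrimitiveRoot_zeta (m : ℕ) : IsPrimitiveRoot (zeta p m) (p ^ m) :=
  (isPrimitiveRoot_zeta_and p m).1

/-- Compatibility: `(ζ (m+1))^p = ζ m`. [cite: Kobayashi2003, §8.4] -/
theorem zeta_succ_pow (m : ℕ) : zeta p (m + 1) ^ p = zeta p m :=
  (isPrimitiveRoot_zeta_and p m).2

/-- `ζ 0 = 1`. [folklore] -/
@[simp] theorem zeta_zero : zeta p 0 = 1 := rfl

/-- Compatibility along the tower: `(ζ (m + j))^{p^j} = ζ m`. [cite: Kobayashi2003, §8.4] -/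
theorem zeta_add_pow (m j : ℕ) : zeta p (m + j) ^ p ^ j = zeta p m := by
  induction j with
  | zero => simp
  | succ j ih => rw [pow_succ', pow_mul, ← add_assoc, zeta_succ_pow, ih]

/-- Beyond the top: `(ζ m)^{p^j} = 1` for `m ≤ j`. [folklore] -/
theorem zeta_pow_eq_one_of_le {m j : ℕ} (h : m ≤ j) : zeta p m ^ p ^ j = 1 := by
  obtain ⟨i, rfl⟩ := Nat.exists_eq_add_of_le h
  rw [pow_add, pow_mul, (isPrimitiveRoot_zeta p m).pow_eq_one, one_pow]

/-- `‖ζ m‖ = 1` (a root of unity). [folklore] -/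
theorem norm_zeta (m : ℕ) : ‖zeta p m‖ = 1 :=
  (isOfFinOrder_iff_pow_eq_one.2 ⟨p ^ m, pow_pos hp.out.pos m,
    (isPrimitiveRoot_zeta p m).pow_eq_one⟩).norm_eq_one

/-! ## §2 `‖ζ_{p^m} − 1‖^{φ(p^m)} = ‖p‖` -/

/-- All primitive `p^m`-th roots `μ` have the same `‖μ − 1‖` as `ζ m`. [folklore] -/
theorem norm_sub_one_eq_of_isPrimitiveRoot {m : ℕ} {μ : PadicAlgCl p}
    (hμ : IsPrimitiveRoot μ (p ^ m)) : ‖μ - 1‖ = ‖zeta p m - 1‖ := by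
  obtain ⟨i, -, rfl⟩ := (isPrimitiveRoot_zeta p m).eq_pow_of_pow_eq_one hμ.pow_eq_one
  obtain ⟨j, -, hj⟩ := hμ.eq_pow_of_pow_eq_one (isPrimitiveRoot_zeta p m).pow_eq_one
  apply le_antisymm (Literature.NumberTheory.GaloisRepresentations.PadicAlgCl.norm_pow_sub_one_le (norm_zeta p m).le i)
  conv_lhs => rw [← hj]
  exact Literature.NumberTheory.GaloisRepresentations.PadicAlgCl.norm_pow_sub_one_le (by rw [norm_pow, norm_zeta, one_pow]) j

/-- **`‖ζ m − 1‖^{φ(p^m)} = ‖p‖`** for `m ≥ 1`: `∏ (1 − μ) = Φ_{p^m}(1) = p` over the primitive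
`p^m`-th roots `μ`, all factors of the same absolute value. [cite: SerreLocalFields1979, Ch. IV §4] -/
theorem norm_zeta_sub_one_pow {m : ℕ} (hm : 1 ≤ m) :
    ‖zeta p m - 1‖ ^ (p ^ m).totient = ‖(p : PadicAlgCl p)‖ := by
  obtain ⟨k, rfl⟩ := Nat.exists_eq_add_of_le' hm
  have hζ := isPrimitiveRoot_zeta p (k + 1)
  have heval : ((cyclotomic (p ^ (k + 1)) (PadicAlgCl p)).eval 1) = p :=
    eval_one_cyclotomic_prime_pow k
  rw [cyclotomic_eq_prod_X_sub_primitiveRoots hζ, eval_prod] at heval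
  simp only [eval_sub, eval_X, eval_C] at heval
  have hnorm := congrArg (fun x : PadicAlgCl p => ‖x‖) heval
  simp only [norm_prod] at hnorm
  rw [← hnorm]
  have hconst : ∀ μ ∈ primitiveRoots (p ^ (k + 1)) (PadicAlgCl p), ‖1 - μ‖ = ‖zeta p (k + 1) - 1‖ := by
    intro μ hμ
    rw [norm_sub_rev]
    exact norm_sub_one_eq_of_isPrimitiveRoot p ((mem_primitiveRoots (pow_pos hp.out.pos _)).mp hμ)
  rw [Finset.prod_congr rfl hconst, Finset.prod_const, hζ.card_primitiveRoots]

/-- `0 < ‖ζ m − 1‖` for `m ≥ 1`. [folklore] -/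
theorem norm_zeta_sub_one_pos {m : ℕ} (hm : 1 ≤ m) : 0 < ‖zeta p m - 1‖ := by
  rw [norm_pos_iff, sub_ne_zero]
  intro h
  have h1 := (isPrimitiveRoot_zeta p m).pow_eq_one_iff_dvd 1
  rw [pow_one] at h1
  have : p ^ m ∣ 1 := h1.mp h
  have hp1 : 1 < p ^ m := Nat.one_lt_pow (by omega) hp.out.one_lt
  exact absurd (Nat.le_of_dvd one_pos this) (not_le.mpr hp1)

/-- `‖ζ m − 1‖ ≤ 1`. [folklore] -/
theorem norm_zeta_sub_one_le_one (m : ℕ) : ‖zeta p m - 1‖ ≤ 1 := by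
  rw [sub_eq_add_neg]
  refine (IsUltrametricDist.norm_add_le_max _ _).trans (max_le (norm_zeta p m).le ?_)
  rw [norm_neg, norm_one]

/-- `‖ζ m − 1‖ < 1` for `m ≥ 1` (`‖ζ − 1‖^{φ} = ‖p‖ < 1`). [folklore] -/
theorem norm_zeta_sub_one_lt_one {m : ℕ} (hm : 1 ≤ m) : ‖zeta p m - 1‖ < 1 := by
  by_contra h
  push Not at h
  have h1 : ‖zeta p m - 1‖ = 1 := le_antisymm (norm_zeta_sub_one_le_one p m) h
  have := norm_zeta_sub_one_pow p hm
  rw [h1, one_pow] at this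
  exact absurd this.symm (Literature.NumberTheory.GaloisRepresentations.PadicAlgCl.norm_natCast_prime_pos_lt_one (p := p)).2.ne

end PadicCyclotomicTower

end Summit.BirchSwinnertonDyer.Rank1Residual.Additive

end
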